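import Literature.Computability.Complexity.Classes
import Literature.Computability.Complexity.Nondeterministic
import Literature.Computability.Complexity.PolyHierarchy
import Literature.Computability.Complexity.CircuitClasses
import HarnessLib

/-!
# Collapses of exponential time under polynomial-size circuits: Meyer, IKW (named facts)

Family `PNP` / trunk `CplxCore`. Two classical "nonuniform upper bound ⟹ uniform collapse"
theorems for the exponential classes, companions of the Karp–Lipton theorem
(`Literature.Computability.Complexity.karp_lipton`, `StructuralPH.lean`), stated over the tree's classes `EXP`
(`Classes.lean`), `NEXP` (`Nondeterministic.lean`), `SigmaP`, `PH` (`PolyHierarchy.lean`) and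
`PPoly` (`CircuitClasses.lean`):

* `EXP_eq_SigmaP_two_of_subset_PPoly` — **Meyer's theorem** (Karp–Lipton 1980, attributed to
  A. Meyer; Arora–Barak 2009, Thm. 6.20): `EXP ⊆ P/poly ⟹ EXP = Σ₂ᵖ`;
* `NEXP_eq_EXP_of_subset_PPoly` — **Impagliazzo–Kabanets–Wigderson** (JCSS 2002, the "easy
  witness" method; Arora–Barak 2009, Lemma 20.20): `NEXP ⊆ P/poly ⟹ NEXP = EXP`.

Both are named facts (`def … : Prop`): Meyer's theorem needs oblivious exponential-time
machines and the `Σ₂` guessing of transcript circuits; IKW needs the Nisan–Wigderson generator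
from worst-case hardness, `EXP ⊆ P/poly ⟹ EXP = MA` (Babai–Fortnow–Lund / BFNW) and a
diagonalization against advice-taking `NTIME` — none of which is in the tree. From them we
prove the consequences used by the Kabanets–Impagliazzo theorem (Arora–Barak 2009, proof of
Thm. 20.17: "`NEXP ⊆ P/poly` together with Lemmas 20.18 and 20.20 imply `NEXP = EXP = MA` ...
`MA ⊆ PH`"), in the `MA`-free form `NEXP ⊆ P/poly ⟹ NEXP = EXP = Σ₂ᵖ ⊆ PH`
(`NEXP_subset_PH_of_subset_PPoly`).

Mathlib has no complexity classes; nothing here duplicates Mathlib. The tree has Karp–Lipton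
(`karp_lipton`) and Kannan (`kannan`) but neither Meyer's theorem nor IKW (searched `Meyer`,
`EXP ⊆ PPoly`, `NEXP = EXP`, `easy witness`).

## References

* R. M. Karp, R. J. Lipton, *Some connections between nonuniform and uniform complexity
  classes*, STOC 1980, 302–309 (Meyer's theorem is stated there and attributed to A. Meyer;
  cf. Arora–Barak 2009, notes to Ch. 6).
* R. Impagliazzo, V. Kabanets, A. Wigderson, *In search of an easy witness: exponential time vs.
  probabilistic polynomial time*, J. Comput. System Sci. 65 (2002) 672–694.
* S. Arora, B. Barak, *Computational Complexity: A Modern Approach*, CUP 2009, Thm. 6.20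
  (p. 114), Lemma 20.20 (p. 417), proof of Thm. 20.17 (p. 418).
-/

noncomputable section

namespace Literature.Computability.Complexity


/-! ### The two named facts -/

/-- **Meyer's theorem** (Karp–Lipton 1980, attributed to A. Meyer; Arora–Barak 2009, Thm. 6.20,
p. 114: "If `EXP ⊆ P/poly` then `EXP = Σ₂ᵖ`"). Printed proof sketch: an `L ∈ EXP` is decided by a
`2^{p(n)}`-time oblivious TM; under `EXP ⊆ P/poly` a polynomial-size circuit computes the `i`-th
snapshot from `i`, and `x ∈ L` iff `∃` such a circuit `∀` indices the local consistency checks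
pass — a `Σ₂ᵖ` predicate. Over the tree's `EXP`, `PPoly`, `SigmaP 2`. Named fact.
[cite: AroraBarakCC2009, Thm. 6.20 (p. 114)] -/
def EXP_eq_SigmaP_two_of_subset_PPoly : Prop :=
  EXP ⊆ PPoly → EXP = SigmaP 2

/-- **Impagliazzo–Kabanets–Wigderson** (JCSS 65 (2002); Arora–Barak 2009, Lemma 20.20, p. 417:
"`NEXP ⊆ P/poly ⟹ NEXP = EXP`"). Printed proof (easy witness method): if `NEXP ≠ EXP`, some
`L ∈ NEXP \ EXP` has, infinitely often, only certificates of high circuit complexity, which feed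
a Nisan–Wigderson generator derandomising the `MA` protocol for `EXP` (`EXP ⊆ P/poly ⟹ EXP = MA`,
Lemma 20.18) into advice-taking `NTIME(2^{n^c})`, contradicting `NEXP ⊆ P/poly` by
diagonalization. Over the tree's `NEXP`, `PPoly`, `EXP`. Named fact.
[cite: AroraBarakCC2009, Lemma 20.20 (p. 417)] -/
def NEXP_eq_EXP_of_subset_PPoly : Prop :=
  NEXP ⊆ PPoly → NEXP = EXP

/-! ### Consequences (proved from the facts) -/

/-- Under Meyer's theorem, `EXP ⊆ P/poly ⟹ EXP ⊆ PH` (`Σ₂ᵖ ⊆ PH`).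
[cite: AroraBarakCC2009, Thm. 6.20 (p. 114)] -/
theorem EXP_subset_PH_of_subset_PPoly (hM : EXP_eq_SigmaP_two_of_subset_PPoly)
    (h : EXP ⊆ PPoly) : EXP ⊆ PH := by
  rw [hM h]
  exact SigmaP_subset_PH 2

/-- **`NEXP ⊆ P/poly ⟹ NEXP ⊆ PH`** (from IKW and Meyer): `NEXP = EXP` (Lemma 20.20), so
`EXP ⊆ P/poly` and `EXP = Σ₂ᵖ ⊆ PH` (Thm. 6.20). This is the `MA`-free form of the step
"`NEXP = EXP = MA` and `MA ⊆ PH`" in Arora–Barak's proof of the Kabanets–Impagliazzo theorem.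
[cite: AroraBarakCC2009, proof of Thm. 20.17 (p. 418)] -/
theorem NEXP_subset_PH_of_subset_PPoly (hI : NEXP_eq_EXP_of_subset_PPoly)
    (hM : EXP_eq_SigmaP_two_of_subset_PPoly) (h : NEXP ⊆ PPoly) : NEXP ⊆ PH := by
  have hE : NEXP = EXP := hI h
  rw [hE] at h ⊢
  exact EXP_subset_PH_of_subset_PPoly hM h

/-- **`NEXP ⊆ P/poly ⟹ NEXP = Σ₂ᵖ`** (from IKW and Meyer).
[cite: AroraBarakCC2009, Thm. 6.20 (p. 114) and Lemma 20.20 (p. 417)] -/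
theorem NEXP_eq_SigmaP_two_of_subset_PPoly (hI : NEXP_eq_EXP_of_subset_PPoly)
    (hM : EXP_eq_SigmaP_two_of_subset_PPoly) (h : NEXP ⊆ PPoly) : NEXP = SigmaP 2 := by
  have hE : NEXP = EXP := hI h
  rw [hE] at h ⊢
  exact hM h

/-- Under IKW, `NEXP ⊆ P/poly` makes `NEXP` closed under complement (`co NEXP = NEXP`), because
`EXP` is (`compl_mem_DTIME_iff`). This is the "`NEXP = coNEXP`" of Kabanets–Impagliazzo 2003,
proof of Thm. 18. [cite: AroraBarakCC2009, Lemma 20.20 (p. 417)] -/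
theorem co_NEXP_eq_of_subset_PPoly (hI : NEXP_eq_EXP_of_subset_PPoly) (h : NEXP ⊆ PPoly) :
    co NEXP = NEXP := by
  rw [hI h]
  refine co_eq_self_of_compl_mem_iff fun L => ?_
  simp only [EXP, Set.mem_iUnion, compl_mem_DTIME_iff]

end Literature.Computability.Complexity

end
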